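import Mathlib
import Literature.Analysis.FluidPDE.LocalTypeISliceMorrey
import Literature.Analysis.FluidPDE.AxisDistancePowerIntegral
import Summits.NavierStokesRegularity.NavierStokesRegularity.Theorems.LocalSineTubeDoorProfileAlignedWindowRigidityAncient
import HarnessLib

/-!
# AxisTwistDoor · crux `TiltDominationLoc` (stmt-NavierStokesRegularity-26991) · birth skeleton STUB 1
# `stub_neckLength`, part A — circle Cauchy–Schwarz and the cylindrical lower bound

ns-idea-6's birth skeleton `TiltDominationLoc_birth.lean` (registered 2026-08-28T08:50:41Z), STUB 1 (M,
provable-first): the set of heights at which the axis circulation `Γ(r,z,s) = ∫₀^{2π} ⟪v(s)(r cos θ, r sin θ, z),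
(−sin θ, cos θ, 0)⟫ r dθ` stays `≥ c` for all radii `r ∈ (ρ, R)` has length `≤ A·R/(c² log(R/ρ))`.  This file:
(1) on a circle, `c ≤ Γ(r,z)` forces `∫₀^{2π} |w|² dθ ≥ c²/(2πr²)` (Cauchy–Schwarz, by AM–GM);
(2) cylindrical Tonelli (`Literature…lintegral_eq_lintegral_cylindrical`) integrates this over `ρ < r < R` (weight
`r dr`: `∫ dr/r = log(R/ρ)`) and over the (measurable: open ∩ closed) height set, inside the ball `B((0,0,z₀), 2R)`:
`(c²/(2π)) log(R/ρ) · |heights| ≤ ∫_{B((0,0,z₀),2R)} |w|²` (`lintegral_ball_ge_neck`).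
Part B (`…TiltDominationLocSliceEnergy`) bounds the right side for class profiles; part C assembles the stub.

Seat ns-el-k1b g0 (LEAD ns-atd-p1's pointer, 2026-08-28T10:56Z).  WHAT THIS IS NOT: not a statement about
Navier–Stokes regularity and not the crux `TiltDominationLoc` (XL, research): its provable-first stub only.
[cite: KochNadirashviliSereginSverak2009, §5; AlbrittonBarker2019, §1]
-/

noncomputable section

-- the summit and its single sub-problem share the name (CONVENTIONS §1), as in every Theorems file
set_option linter.dupNamespace false

namespace Summit.NavierStokesRegularity.NavierStokesRegularity.Theorems.TiltDominationLoc.NeckLength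

open scoped Topology InnerProductSpace NNReal ENNReal
open Set Function MeasureTheory Filter Metric
open Literature.Analysis Literature.Analysis.FluidPDE
open Summit.NavierStokesRegularity.NavierStokesRegularity.Theorems.LocalSineTubeDoorProfileAlignedWindowRigidityAncient
  (continuous_slice bdd_of_hasTypeITimeDecay)

/-! ### circles about the vertical axis -/

/-- A continuous field restricted to the circle `θ ↦ (r cos θ, r sin θ, z)` is continuous in `θ`. -/
theorem continuous_comp_circlePt {w : EuclideanSpace ℝ (Fin 3) → EuclideanSpace ℝ (Fin 3)} (hw : Continuous w) (r z : ℝ) :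
    Continuous fun θ : ℝ => w (WithLp.toLp 2 ![r * Real.cos θ, r * Real.sin θ, z] : EuclideanSpace ℝ (Fin 3)) := by
  refine hw.comp ((PiLp.continuous_toLp 2 _).comp (continuous_pi fun i => ?_))
  fin_cases i <;> simp <;> fun_prop

/-- The circle point is jointly continuous in `(θ, z)`. -/
theorem continuous_circlePt₂ (r : ℝ) :
    Continuous fun q : ℝ × ℝ => (WithLp.toLp 2 ![r * Real.cos q.1, r * Real.sin q.1, q.2] : EuclideanSpace ℝ (Fin 3)) := by
  refine (PiLp.continuous_toLp 2 _).comp (continuous_pi fun i => ?_)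
  fin_cases i <;> simp <;> fun_prop

/-- The circle point is jointly continuous in `(θ, r)` (for the cylindrical Tonelli step). -/
theorem continuous_circlePt₃ (z : ℝ) :
    Continuous fun q : ℝ × ℝ => (WithLp.toLp 2 ![q.2 * Real.cos q.1, q.2 * Real.sin q.1, z] : EuclideanSpace ℝ (Fin 3)) := by
  refine (PiLp.continuous_toLp 2 _).comp (continuous_pi fun i => ?_)
  fin_cases i <;> simp <;> fun_prop

/-- The unit tangent `(−sin θ, cos θ, 0)` is continuous in `θ`. -/
theorem continuous_tangent :
    Continuous fun θ : ℝ => (WithLp.toLp 2 ![-Real.sin θ, Real.cos θ, 0] : EuclideanSpace ℝ (Fin 3)) := by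
  refine (PiLp.continuous_toLp 2 _).comp (continuous_pi fun i => ?_)
  fin_cases i <;> simp <;> fun_prop

/-- `‖(−sin θ, cos θ, 0)‖ = 1`. -/
theorem norm_tangent (θ : ℝ) : ‖(WithLp.toLp 2 ![-Real.sin θ, Real.cos θ, 0] : EuclideanSpace ℝ (Fin 3))‖ = 1 := by
  rw [EuclideanSpace.norm_eq, Fin.sum_univ_three]
  simp only [Matrix.cons_val_zero, Matrix.cons_val_one, Matrix.cons_val, Real.norm_eq_abs,
    sq_abs]
  rw [show (-Real.sin θ) ^ 2 + Real.cos θ ^ 2 + (0 : ℝ) ^ 2 = 1 by nlinarith [Real.sin_sq_add_cos_sq θ],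
    Real.sqrt_one]

/-- The circle point is `2π`-periodic in `θ`. -/
theorem circlePt_add_two_pi (r z θ : ℝ) :
    (WithLp.toLp 2 ![r * Real.cos (θ + 2 * Real.pi), r * Real.sin (θ + 2 * Real.pi), z] : EuclideanSpace ℝ (Fin 3)) =
      WithLp.toLp 2 ![r * Real.cos θ, r * Real.sin θ, z] := by
  rw [Real.cos_add_two_pi, Real.sin_add_two_pi]

/-- The cylindrical radius of the circle point: `|r|`. -/
theorem cylRadius_circlePt (r θ z : ℝ) :
    cylRadius (WithLp.toLp 2 ![r * Real.cos θ, r * Real.sin θ, z] : EuclideanSpace ℝ (Fin 3)) = |r| := by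
  rw [cylRadius]
  have e : (r * Real.cos θ) ^ 2 + (r * Real.sin θ) ^ 2 = r ^ 2 := by
    linear_combination r ^ 2 * Real.sin_sq_add_cos_sq θ
  simp only [Matrix.cons_val_zero, Matrix.cons_val_one]
  rw [e, Real.sqrt_sq_eq_abs]

/-- The circle point of radius `r < R'` at a height within `R'` of `z₀` lies in the ball `B((0,0,z₀), 2R')`. -/
theorem circlePt_mem_ball {r R' z z₀ : ℝ} (hr0 : 0 ≤ r) (hr : r < R') (hz : |z - z₀| < R') (θ : ℝ) :
    (WithLp.toLp 2 ![r * Real.cos θ, r * Real.sin θ, z] : EuclideanSpace ℝ (Fin 3)) ∈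
      ball (WithLp.toLp 2 ![0, 0, z₀] : EuclideanSpace ℝ (Fin 3)) (2 * R') := by
  rw [mem_ball, EuclideanSpace.dist_eq, Fin.sum_univ_three]
  simp only [Matrix.cons_val_zero, Matrix.cons_val_one, Matrix.cons_val, Real.dist_eq,
    sub_zero, sq_abs]
  have e : (r * Real.cos θ) ^ 2 + (r * Real.sin θ) ^ 2 = r ^ 2 := by
    linear_combination r ^ 2 * Real.sin_sq_add_cos_sq θ
  rw [e]
  have hR : 0 < R' := hr0.trans_lt hr
  have h1 : r ^ 2 + (z - z₀) ^ 2 < (2 * R') ^ 2 := by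
    have hz2 : (z - z₀) ^ 2 < R' ^ 2 := by
      have := abs_lt.1 hz
      nlinarith
    nlinarith
  calc Real.sqrt (r ^ 2 + (z - z₀) ^ 2) < Real.sqrt ((2 * R') ^ 2) := Real.sqrt_lt_sqrt (by positivity) h1
    _ = 2 * R' := Real.sqrt_sq (by linarith)

/-! ### step (1): circulation ≥ c forces circle energy ≥ c²/(2πr²) -/

/-- **Circle Cauchy–Schwarz (by AM–GM).**  If the circulation of a continuous field around the circle `S(r,z)`,
`r > 0`, is `≥ c > 0`, then `∫₀^{2π} |w|² dθ ≥ c²/(2πr²)` on that circle. -/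
theorem sq_integral_ge_of_circ_ge {w : EuclideanSpace ℝ (Fin 3) → EuclideanSpace ℝ (Fin 3)} (hw : Continuous w)
    {c r : ℝ} (hc : 0 < c) (hr : 0 < r) (z : ℝ)
    (hΓ : c ≤ ∫ θ in (0 : ℝ)..(2 * Real.pi), ⟪w (WithLp.toLp 2 ![r * Real.cos θ, r * Real.sin θ, z] : EuclideanSpace ℝ (Fin 3)),
      (WithLp.toLp 2 ![-Real.sin θ, Real.cos θ, 0] : EuclideanSpace ℝ (Fin 3))⟫_ℝ * r) :
    c ^ 2 / (2 * Real.pi * r ^ 2) ≤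
      ∫ θ in (0 : ℝ)..(2 * Real.pi), ‖w (WithLp.toLp 2 ![r * Real.cos θ, r * Real.sin θ, z] : EuclideanSpace ℝ (Fin 3))‖ ^ 2 := by
  have h2π : (0 : ℝ) ≤ 2 * Real.pi := by positivity
  have hf : Continuous fun θ : ℝ => ‖w (WithLp.toLp 2 ![r * Real.cos θ, r * Real.sin θ, z] : EuclideanSpace ℝ (Fin 3))‖ :=
    (continuous_comp_circlePt hw r z).norm
  -- `∫ ‖w‖ ≥ c / r`
  have h1 : c ≤ r * ∫ θ in (0 : ℝ)..(2 * Real.pi),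
      ‖w (WithLp.toLp 2 ![r * Real.cos θ, r * Real.sin θ, z] : EuclideanSpace ℝ (Fin 3))‖ := by
    rw [← intervalIntegral.integral_const_mul]
    refine hΓ.trans (intervalIntegral.integral_mono_on h2π ?_ ?_ fun θ _ => ?_)
    · exact (((continuous_comp_circlePt hw r z).inner continuous_tangent).mul continuous_const).intervalIntegrable _ _
    · exact (continuous_const.mul hf).intervalIntegrable _ _
    · calc _ ≤ ‖w (WithLp.toLp 2 ![r * Real.cos θ, r * Real.sin θ, z] : EuclideanSpace ℝ (Fin 3))‖ *
            ‖(WithLp.toLp 2 ![-Real.sin θ, Real.cos θ, 0] : EuclideanSpace ℝ (Fin 3))‖ * r := by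
            gcongr; exact real_inner_le_norm _ _
        _ = r * ‖w (WithLp.toLp 2 ![r * Real.cos θ, r * Real.sin θ, z] : EuclideanSpace ℝ (Fin 3))‖ := by
            rw [norm_tangent]; ring
  -- AM–GM with `m = c/(2πr)`
  set m : ℝ := c / (2 * Real.pi * r) with hm
  have hm0 : 0 < m := by positivity
  have h3 : ∫ θ in (0 : ℝ)..(2 * Real.pi),
      (2 * m * ‖w (WithLp.toLp 2 ![r * Real.cos θ, r * Real.sin θ, z] : EuclideanSpace ℝ (Fin 3))‖ - m ^ 2) ≤
      ∫ θ in (0 : ℝ)..(2 * Real.pi), ‖w (WithLp.toLp 2 ![r * Real.cos θ, r * Real.sin θ, z] : EuclideanSpace ℝ (Fin 3))‖ ^ 2 := by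
    refine intervalIntegral.integral_mono_on h2π ?_ ?_ fun θ _ => ?_
    · exact ((continuous_const.mul hf).sub continuous_const).intervalIntegrable _ _
    · exact (hf.pow 2).intervalIntegrable _ _
    · nlinarith [sq_nonneg (‖w (WithLp.toLp 2 ![r * Real.cos θ, r * Real.sin θ, z] : EuclideanSpace ℝ (Fin 3))‖ - m)]
  have hi1 : IntervalIntegrable (fun θ : ℝ =>
      2 * m * ‖w (WithLp.toLp 2 ![r * Real.cos θ, r * Real.sin θ, z] : EuclideanSpace ℝ (Fin 3))‖) volume 0 (2 * Real.pi) :=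
    (continuous_const.mul hf).intervalIntegrable _ _
  have hi2 : IntervalIntegrable (fun _ : ℝ => m ^ 2) volume 0 (2 * Real.pi) := intervalIntegrable_const
  rw [intervalIntegral.integral_sub hi1 hi2, intervalIntegral.integral_const_mul, intervalIntegral.integral_const,
    sub_zero, smul_eq_mul] at h3
  have h4 : c / r ≤ ∫ θ in (0 : ℝ)..(2 * Real.pi),
      ‖w (WithLp.toLp 2 ![r * Real.cos θ, r * Real.sin θ, z] : EuclideanSpace ℝ (Fin 3))‖ := by
    rw [div_le_iff₀ hr]; linarith
  have h5 : 2 * m * (c / r) - 2 * Real.pi * m ^ 2 = c ^ 2 / (2 * Real.pi * r ^ 2) := by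
    rw [hm]; field_simp; ring
  nlinarith [mul_le_mul_of_nonneg_left h4 (by positivity : (0 : ℝ) ≤ 2 * m)]

/-- Step (1) in `lintegral` form on the fundamental interval `(−π, π)` of the cylindrical Tonelli identity. -/
theorem lintegral_circle_ge_of_circ_ge {w : EuclideanSpace ℝ (Fin 3) → EuclideanSpace ℝ (Fin 3)} (hw : Continuous w)
    {c r : ℝ} (hc : 0 < c) (hr : 0 < r) (z : ℝ)
    (hΓ : c ≤ ∫ θ in (0 : ℝ)..(2 * Real.pi), ⟪w (WithLp.toLp 2 ![r * Real.cos θ, r * Real.sin θ, z] : EuclideanSpace ℝ (Fin 3)),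
      (WithLp.toLp 2 ![-Real.sin θ, Real.cos θ, 0] : EuclideanSpace ℝ (Fin 3))⟫_ℝ * r) :
    ENNReal.ofReal (c ^ 2 / (2 * Real.pi * r ^ 2)) ≤
      ∫⁻ θ in Ioo (-Real.pi) Real.pi, ‖w (WithLp.toLp 2 ![r * Real.cos θ, r * Real.sin θ, z] : EuclideanSpace ℝ (Fin 3))‖ₑ ^ 2 := by
  have hf : Continuous fun θ : ℝ => ‖w (WithLp.toLp 2 ![r * Real.cos θ, r * Real.sin θ, z] : EuclideanSpace ℝ (Fin 3))‖ ^ 2 :=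
    ((continuous_comp_circlePt hw r z).norm).pow 2
  have hper : Function.Periodic
      (fun θ : ℝ => ‖w (WithLp.toLp 2 ![r * Real.cos θ, r * Real.sin θ, z] : EuclideanSpace ℝ (Fin 3))‖ ^ 2) (2 * Real.pi) := by
    intro θ
    simp only [circlePt_add_two_pi]
  have h1 := sq_integral_ge_of_circ_ge hw hc hr z hΓ
  -- move the interval `(0, 2π)` to `(−π, π)`
  have h2 : ∫ θ in (0 : ℝ)..(2 * Real.pi), ‖w (WithLp.toLp 2 ![r * Real.cos θ, r * Real.sin θ, z] : EuclideanSpace ℝ (Fin 3))‖ ^ 2 =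
      ∫ θ in (-Real.pi)..Real.pi, ‖w (WithLp.toLp 2 ![r * Real.cos θ, r * Real.sin θ, z] : EuclideanSpace ℝ (Fin 3))‖ ^ 2 := by
    have e1 := hper.intervalIntegral_add_eq 0 (-Real.pi)
    rw [zero_add, show -Real.pi + 2 * Real.pi = Real.pi by ring] at e1
    exact e1
  rw [h2, intervalIntegral.integral_of_le (by linarith [Real.pi_pos])] at h1
  -- Bochner → Lebesgue
  have h3 : ∫⁻ θ in Ioo (-Real.pi) Real.pi,
      ‖w (WithLp.toLp 2 ![r * Real.cos θ, r * Real.sin θ, z] : EuclideanSpace ℝ (Fin 3))‖ₑ ^ 2 =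
      ∫⁻ θ in Ioc (-Real.pi) Real.pi, ENNReal.ofReal
        (‖w (WithLp.toLp 2 ![r * Real.cos θ, r * Real.sin θ, z] : EuclideanSpace ℝ (Fin 3))‖ ^ 2) := by
    rw [← restrict_Ioo_eq_restrict_Ioc]
    refine lintegral_congr fun θ => ?_
    rw [← ofReal_norm, ← ENNReal.ofReal_pow (norm_nonneg _)]
  rw [h3, ← ofReal_integral_eq_lintegral_ofReal (hf.integrableOn_Ioc) (ae_of_all _ fun θ => sq_nonneg _)]
  exact ENNReal.ofReal_le_ofReal h1

/-! ### step (2): cylindrical integration over the neck -/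

set_option maxHeartbeats 400000 in
/-- The axis circulation `Γ_w(r, z) = ∫₀^{2π} ⟪w(r cos θ, r sin θ, z), (−sin θ, cos θ, 0)⟫ r dθ` is continuous in the
height `z` (parametric integral of a jointly continuous integrand). -/
theorem continuous_circ_height {w : EuclideanSpace ℝ (Fin 3) → EuclideanSpace ℝ (Fin 3)} (hw : Continuous w) (r : ℝ) :
    Continuous fun z : ℝ => ∫ θ in (0 : ℝ)..(2 * Real.pi), ⟪w (WithLp.toLp 2 ![r * Real.cos θ, r * Real.sin θ, z] : EuclideanSpace ℝ (Fin 3)), (WithLp.toLp 2 ![-Real.sin θ, Real.cos θ, 0] : EuclideanSpace ℝ (Fin 3))⟫_ℝ * r := by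
  have hF : Continuous (uncurry fun (z θ : ℝ) => ⟪w (WithLp.toLp 2 ![r * Real.cos θ, r * Real.sin θ, z] : EuclideanSpace ℝ (Fin 3)), (WithLp.toLp 2 ![-Real.sin θ, Real.cos θ, 0] : EuclideanSpace ℝ (Fin 3))⟫_ℝ * r) := by
    have h1 : Continuous fun q : ℝ × ℝ => w (WithLp.toLp 2 ![r * Real.cos q.2, r * Real.sin q.2, q.1] : EuclideanSpace ℝ (Fin 3)) :=
      hw.comp ((continuous_circlePt₂ r).comp continuous_swap)
    have h2 : Continuous fun q : ℝ × ℝ => (WithLp.toLp 2 ![-Real.sin q.2, Real.cos q.2, 0] : EuclideanSpace ℝ (Fin 3)) :=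
      continuous_tangent.comp continuous_snd
    exact (h1.inner h2).mul continuous_const
  exact intervalIntegral.continuous_parametric_intervalIntegral_of_continuous' (μ := volume) hF 0 (2 * Real.pi)

/-- The height set of the neck, `{z : |z − z₀| < R, Γ_w(r,z) ≥ c for all r ∈ (ρ,R)}`, is measurable (open ∩ closed). -/
theorem measurableSet_neckSet {w : EuclideanSpace ℝ (Fin 3) → EuclideanSpace ℝ (Fin 3)} (hw : Continuous w) (c ρ R z₀ : ℝ) :
    MeasurableSet {z : ℝ | |z - z₀| < R ∧ ∀ r : ℝ, ρ < r → r < R → c ≤ ∫ θ in (0 : ℝ)..(2 * Real.pi), ⟪w (WithLp.toLp 2 ![r * Real.cos θ, r * Real.sin θ, z] : EuclideanSpace ℝ (Fin 3)), (WithLp.toLp 2 ![-Real.sin θ, Real.cos θ, 0] : EuclideanSpace ℝ (Fin 3))⟫_ℝ * r} := by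
  have e : {z : ℝ | |z - z₀| < R ∧ ∀ r : ℝ, ρ < r → r < R → c ≤ ∫ θ in (0 : ℝ)..(2 * Real.pi), ⟪w (WithLp.toLp 2 ![r * Real.cos θ, r * Real.sin θ, z] : EuclideanSpace ℝ (Fin 3)), (WithLp.toLp 2 ![-Real.sin θ, Real.cos θ, 0] : EuclideanSpace ℝ (Fin 3))⟫_ℝ * r} =
      {z : ℝ | |z - z₀| < R} ∩ ⋂ r : ℝ, ⋂ (_ : ρ < r), ⋂ (_ : r < R), {z : ℝ | c ≤ ∫ θ in (0 : ℝ)..(2 * Real.pi), ⟪w (WithLp.toLp 2 ![r * Real.cos θ, r * Real.sin θ, z] : EuclideanSpace ℝ (Fin 3)), (WithLp.toLp 2 ![-Real.sin θ, Real.cos θ, 0] : EuclideanSpace ℝ (Fin 3))⟫_ℝ * r} := by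
    ext z
    simp only [mem_setOf_eq, mem_inter_iff, mem_iInter]
  rw [e]
  refine (isOpen_lt (continuous_abs.comp (continuous_id.sub continuous_const)) continuous_const).measurableSet.inter ?_
  refine (isClosed_iInter fun r => isClosed_iInter fun _ => isClosed_iInter fun _ => ?_).measurableSet
  exact isClosed_le continuous_const (continuous_circ_height hw r)

/-- `∫_ρ^R (c²/(2π)) r⁻¹ dr = (c²/(2π)) log(R/ρ)` as a lower Lebesgue integral. -/
theorem lintegral_inv_weight {c ρ R : ℝ} (hρ : 0 < ρ) (hρR : ρ < R) :
    ∫⁻ r in Ioo ρ R, ENNReal.ofReal (c ^ 2 / (2 * Real.pi) * r⁻¹) =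
      ENNReal.ofReal (c ^ 2 / (2 * Real.pi) * Real.log (R / ρ)) := by
  have hR : 0 < R := hρ.trans hρR
  have hint : IntegrableOn (fun r : ℝ => c ^ 2 / (2 * Real.pi) * r⁻¹) (Ioo ρ R) := by
    have h1 : IntervalIntegrable (fun r : ℝ => r⁻¹) volume ρ R :=
      intervalIntegral.intervalIntegrable_inv (fun x hx => by
        have := (Set.mem_uIcc.1 hx); rcases this with ⟨h, _⟩ | ⟨h, _⟩ <;> linarith) continuousOn_id
    have h2 := h1.const_mul (c ^ 2 / (2 * Real.pi))
    rw [intervalIntegrable_iff_integrableOn_Ioo_of_le hρR.le] at h2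
    exact h2
  have hnn : 0 ≤ᵐ[volume.restrict (Ioo ρ R)] fun r : ℝ => c ^ 2 / (2 * Real.pi) * r⁻¹ :=
    (ae_restrict_iff' measurableSet_Ioo).2 (Eventually.of_forall fun r hr => by
      have : 0 < r := hρ.trans hr.1
      positivity)
  rw [← ofReal_integral_eq_lintegral_ofReal hint hnn]
  congr 1
  rw [← integral_Ioc_eq_integral_Ioo, ← intervalIntegral.integral_of_le hρR.le, intervalIntegral.integral_const_mul,
    integral_inv_of_pos hρ hR]

/-- **Step (2): the slice energy in the ball `B((0,0,z₀), 2R)` controls the length of the neck.**  For a continuous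
field `w`, `c > 0` and `0 < ρ < R`:
`(c²/(2π)) log(R/ρ) · |{z : |z−z₀| < R, Γ_w(r,z) ≥ c ∀ r ∈ (ρ,R)}| ≤ ∫_{B((0,0,z₀),2R)} |w|²`
(cylindrical Tonelli, the circle bound of step (1) on every circle of the neck, `∫_ρ^R dr/r = log(R/ρ)`). -/
theorem lintegral_ball_ge_neck {w : EuclideanSpace ℝ (Fin 3) → EuclideanSpace ℝ (Fin 3)} (hw : Continuous w)
    {c ρ R : ℝ} (hc : 0 < c) (hρ : 0 < ρ) (hρR : ρ < R) (z₀ : ℝ) :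
    ENNReal.ofReal (c ^ 2 / (2 * Real.pi) * Real.log (R / ρ)) *
        volume {z : ℝ | |z - z₀| < R ∧ ∀ r : ℝ, ρ < r → r < R → c ≤ ∫ θ in (0 : ℝ)..(2 * Real.pi), ⟪w (WithLp.toLp 2 ![r * Real.cos θ, r * Real.sin θ, z] : EuclideanSpace ℝ (Fin 3)), (WithLp.toLp 2 ![-Real.sin θ, Real.cos θ, 0] : EuclideanSpace ℝ (Fin 3))⟫_ℝ * r} ≤
      ∫⁻ y in ball (WithLp.toLp 2 ![0, 0, z₀] : EuclideanSpace ℝ (Fin 3)) (2 * R), ‖w y‖ₑ ^ 2 := by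
  set G : Set ℝ := {z : ℝ | |z - z₀| < R ∧ ∀ r : ℝ, ρ < r → r < R → c ≤ ∫ θ in (0 : ℝ)..(2 * Real.pi), ⟪w (WithLp.toLp 2 ![r * Real.cos θ, r * Real.sin θ, z] : EuclideanSpace ℝ (Fin 3)), (WithLp.toLp 2 ![-Real.sin θ, Real.cos θ, 0] : EuclideanSpace ℝ (Fin 3))⟫_ℝ * r} with hG
  have hGm : MeasurableSet G := measurableSet_neckSet hw c ρ R z₀
  set B : Set (EuclideanSpace ℝ (Fin 3)) := ball (WithLp.toLp 2 ![0, 0, z₀] : EuclideanSpace ℝ (Fin 3)) (2 * R) with hB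
  have hfm : Measurable fun y : EuclideanSpace ℝ (Fin 3) => ‖w y‖ₑ ^ 2 := hw.measurable.enorm.pow_const 2
  have hFm : Measurable (B.indicator fun y : EuclideanSpace ℝ (Fin 3) => ‖w y‖ₑ ^ 2) := hfm.indicator measurableSet_ball
  rw [← lintegral_indicator measurableSet_ball, lintegral_eq_lintegral_cylindrical hFm]
  -- the lower bound at every height of the neck
  have hz : ∀ z ∈ G, ENNReal.ofReal (c ^ 2 / (2 * Real.pi) * Real.log (R / ρ)) ≤
      ∫⁻ θ in Ioo (-Real.pi) Real.pi, ∫⁻ r in Ioi (0 : ℝ), ENNReal.ofReal r *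
        B.indicator (fun y : EuclideanSpace ℝ (Fin 3) => ‖w y‖ₑ ^ 2)
          (WithLp.toLp 2 ![r * Real.cos θ, r * Real.sin θ, z] : EuclideanSpace ℝ (Fin 3)) := by
    intro z hzG
    obtain ⟨hzz₀, hΓ⟩ := hzG
    -- restrict the radial integral to `(ρ, R)`, where the circle lies in the ball
    have h1 : ∀ θ : ℝ, ∫⁻ r in Ioo ρ R, ENNReal.ofReal r * ‖w (WithLp.toLp 2 ![r * Real.cos θ, r * Real.sin θ, z] : EuclideanSpace ℝ (Fin 3))‖ₑ ^ 2 ≤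
        ∫⁻ r in Ioi (0 : ℝ), ENNReal.ofReal r *
          B.indicator (fun y : EuclideanSpace ℝ (Fin 3) => ‖w y‖ₑ ^ 2) (WithLp.toLp 2 ![r * Real.cos θ, r * Real.sin θ, z] : EuclideanSpace ℝ (Fin 3)) := by
      intro θ
      calc ∫⁻ r in Ioo ρ R, ENNReal.ofReal r * ‖w (WithLp.toLp 2 ![r * Real.cos θ, r * Real.sin θ, z] : EuclideanSpace ℝ (Fin 3))‖ₑ ^ 2
          = ∫⁻ r in Ioo ρ R, ENNReal.ofReal r *
              B.indicator (fun y : EuclideanSpace ℝ (Fin 3) => ‖w y‖ₑ ^ 2) (WithLp.toLp 2 ![r * Real.cos θ, r * Real.sin θ, z] : EuclideanSpace ℝ (Fin 3)) := by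
            refine setLIntegral_congr_fun measurableSet_Ioo fun r hr => ?_
            rw [indicator_of_mem (circlePt_mem_ball (hρ.trans hr.1).le hr.2 hzz₀ θ)]
        _ ≤ _ := lintegral_mono_set (fun r hr => hρ.trans hr.1)
    -- swap the two integrals on `(−π, π) × (ρ, R)`
    have hmeas : Measurable (uncurry fun (θ r : ℝ) => ENNReal.ofReal r * ‖w (WithLp.toLp 2 ![r * Real.cos θ, r * Real.sin θ, z] : EuclideanSpace ℝ (Fin 3))‖ₑ ^ 2) := by
      have h2 : Measurable fun q : ℝ × ℝ => w (WithLp.toLp 2 ![q.2 * Real.cos q.1, q.2 * Real.sin q.1, z] : EuclideanSpace ℝ (Fin 3)) :=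
        hw.measurable.comp (continuous_circlePt₃ z).measurable
      exact (ENNReal.measurable_ofReal.comp measurable_snd).mul (h2.enorm.pow_const 2)
    have hswap : ∫⁻ θ in Ioo (-Real.pi) Real.pi, ∫⁻ r in Ioo ρ R, ENNReal.ofReal r * ‖w (WithLp.toLp 2 ![r * Real.cos θ, r * Real.sin θ, z] : EuclideanSpace ℝ (Fin 3))‖ₑ ^ 2 =
        ∫⁻ r in Ioo ρ R, ∫⁻ θ in Ioo (-Real.pi) Real.pi, ENNReal.ofReal r * ‖w (WithLp.toLp 2 ![r * Real.cos θ, r * Real.sin θ, z] : EuclideanSpace ℝ (Fin 3))‖ₑ ^ 2 :=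
      lintegral_lintegral_swap hmeas.aemeasurable
    -- the circle bound of step (1) on every circle of the neck
    have h3 : ∫⁻ r in Ioo ρ R, ENNReal.ofReal (c ^ 2 / (2 * Real.pi) * r⁻¹) ≤
        ∫⁻ r in Ioo ρ R, ∫⁻ θ in Ioo (-Real.pi) Real.pi, ENNReal.ofReal r * ‖w (WithLp.toLp 2 ![r * Real.cos θ, r * Real.sin θ, z] : EuclideanSpace ℝ (Fin 3))‖ₑ ^ 2 := by
      refine setLIntegral_mono' measurableSet_Ioo fun r hr => ?_
      have hr0 : 0 < r := hρ.trans hr.1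
      have hmr : Measurable fun θ : ℝ => ‖w (WithLp.toLp 2 ![r * Real.cos θ, r * Real.sin θ, z] : EuclideanSpace ℝ (Fin 3))‖ₑ ^ 2 :=
        (continuous_comp_circlePt hw r z).measurable.enorm.pow_const 2
      rw [lintegral_const_mul _ hmr]
      have h4 := lintegral_circle_ge_of_circ_ge hw hc hr0 z (hΓ r hr.1 hr.2)
      calc ENNReal.ofReal (c ^ 2 / (2 * Real.pi) * r⁻¹)
          = ENNReal.ofReal r * ENNReal.ofReal (c ^ 2 / (2 * Real.pi * r ^ 2)) := by
            rw [← ENNReal.ofReal_mul hr0.le]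
            congr 1
            field_simp
        _ ≤ _ := by gcongr
    calc ENNReal.ofReal (c ^ 2 / (2 * Real.pi) * Real.log (R / ρ))
        = ∫⁻ r in Ioo ρ R, ENNReal.ofReal (c ^ 2 / (2 * Real.pi) * r⁻¹) := (lintegral_inv_weight hρ hρR).symm
      _ ≤ _ := h3
      _ = _ := hswap.symm
      _ ≤ _ := lintegral_mono fun θ => h1 θ
  -- integrate over the heights
  calc ENNReal.ofReal (c ^ 2 / (2 * Real.pi) * Real.log (R / ρ)) * volume G
      = ∫⁻ z, G.indicator (fun _ => ENNReal.ofReal (c ^ 2 / (2 * Real.pi) * Real.log (R / ρ))) z :=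
        (lintegral_indicator_const hGm _).symm
    _ ≤ _ := by
        refine lintegral_mono fun z => ?_
        by_cases hzG : z ∈ G
        · rw [indicator_of_mem hzG]
          exact hz z hzG
        · rw [indicator_of_notMem hzG]
          exact bot_le

end Summit.NavierStokesRegularity.NavierStokesRegularity.Theorems.TiltDominationLoc.NeckLength

end
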